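import Literature.Analysis.Complex.LaguerrePolyaStarOrderLtTwo
import Literature.Analysis.Complex.RoucheTheorem
import Literature.Analysis.Complex.JensenCircles
import HarnessLib

/-!
# Differentiation does not increase the number of non-real zeros on `𝓛𝓟*` (Pólya; Kim 1990, §1),
# proved

Topic `Literature/Analysis/Complex` (trunk T-CA); theorem-only companion of `LaguerrePolyaClass.lean`
(definitions `IsLaguerrePolya`, `IsLaguerrePolyaStar`, `nonrealZeroCount`). Everything here is
PROVED; no definitions, no named facts.

Kim 1990, §1 (PAMS 109, p. 1045): "From Rolle's theorem, the classes `𝓛𝓟(I)*` and `𝓛𝓟(I)` are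
closed under differentiation and differentiation does not increase the number of nonreal zeros of a
function in `𝓛𝓟(ℝ)*`"; Ki–Kim 2000, §2 p. 49: "`𝔏` is closed under differentiation, and
differentiation does not increase the number of nonreal zeros of a function in the class `𝔏`. This
fact is an easy consequence of Rolle's theorem, Hurwitz's theorem, and the Laguerre–Pólya
theorem" (and it is the step "it is enough to show that there is a positive integer `n` such that
`f^{(n)}` has only real zeros" in their proof of the Pólya–Wiman theorem, Thm. 2.1).

* `Literature.Analysis.Complex.IsLaguerrePolyaStar.nonrealZeroCount_deriv_le` —
  **`Z_c(F') ≤ Z_c(F)` for every `F ∈ 𝓛𝓟*`**, and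
  `Literature.Analysis.Complex.IsLaguerrePolyaStar.finite_nonreal_zeros_deriv` — the non-real
  zeros of `F'` are finite in number (for `F' ≢ 0`).
* `Literature.Analysis.Complex.IsLaguerrePolyaStar.deriv` — for `F ∈ 𝓛𝓟*` of order `< 2`,
  `F' ∈ 𝓛𝓟*` (the order-`< 2` part of Kim's closure statement; the quotient by the polynomial
  part is handled Hadamard-free by `isLaguerrePolyaStar_of_isEntireOfOrderLt_two`), hence
  `IsLaguerrePolyaStar.iteratedDeriv'` and the **antitone sequence `n ↦ Z_c(F^{(n)})`**
  (`IsLaguerrePolyaStar.nonrealZeroCount_iteratedDeriv_succ_le`,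
  `IsLaguerrePolyaStar.antitone_nonrealZeroCount_iteratedDeriv`) — statement (ii) of LINE L4
  «Jensen edge law» (`stmt-RiemannHypothesis-22178`) together with `PolyaWimanOrderLtTwo.lean`.

## Proof ("Rolle, Hurwitz, Laguerre–Pólya", made quantitative by Rouché)

Write `F = p · φ`, `φ = lim Q_m` locally uniformly with `Q_m` real-rooted real polynomials. Then
`P_m = p Q_m → F` and `P_m' → F'` locally uniformly (Weierstrass), and `Z_c(P_m') ≤ Z_c(P_m) = Z_c(p)`
(Rolle with multiplicity, `Polynomial.card_roots_le_derivative`). If `t₁, …, t_k` are non-real zeros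
of `F' ≢ 0` with orders `m_i`, choose disjoint small circles about them off the real axis on which
`F' ≠ 0`; by **Rouché's theorem in exact-count form** (the tree's
`Rouche.finsum_analyticOrderNatAt_eq_of_norm_sub_lt`) `P_m'` has exactly `m_i` zeros inside the
`i`-th circle for `m` large, all of them non-real, so `∑ m_i ≤ Z_c(P_m') ≤ Z_c(p)`. Hence `F'` has
finitely many non-real zeros and `Z_c(F') ≤ Z_c(p) = Z_c(F)`.

## References

* Y.-O. Kim, Proc. AMS 109 (1990) 1045–1052, §1 p. 1045 [Kim1990].
* H. Ki, Y.-O. Kim, Duke Math. J. 104 (2000) 45–73, §2 p. 49 and proof of Thm. 2.1 [KiKim2000].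
* G. Pólya, *Some problems connected with Fourier's work on transcendental equations*, Quart. J.
  Math. 1 (1930) 21–34 (the original statement for genus `1*`).
* J. B. Conway, *Functions of One Complex Variable I*, Ch. V Thm. 3.8 (Rouché) [Conway1978].
-/

noncomputable section

open Complex Filter Metric Set Topology Polynomial
open scoped ComplexConjugate

namespace Literature.Analysis.Complex

section Deriv

variable {φ F : ℂ → ℂ}

/-! ## Polynomial counts: Rolle, and the count of a product with a real-rooted factor -/

/-- **Rolle with multiplicity**: the derivative of a real polynomial has at most as many non-real
zeros (with multiplicity) as the polynomial — `Z_c(P') ≤ Z_c(P)` — since it has at least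
`#(real roots of P) − 1` real roots (`Polynomial.card_roots_le_derivative`) and degree one less.
(Same statement as the Summits-side
`Summit.RiemannHypothesis.RiemannHypothesis.Theorems.Splittings.JensenCountMonotonicity.nonrealRootCount_derivative_le`
of the polynomial-world Jensen edge law, which `Literature/` cannot import.)
[cite: Kim1990, §1 p. 1045 ("From Rolle's theorem …")] -/
theorem nonrealRootCount_derivative_le (P : ℝ[X]) :
    nonrealRootCount (derivative P) ≤ nonrealRootCount P := by
  have h1 := card_roots_le_derivative P
  have h2 := natDegree_derivative_le P
  have h3 := card_roots' P
  have h4 := card_roots' (derivative P)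
  unfold nonrealRootCount
  omega

/-- Multiplying by a nonzero real-rooted polynomial does not change `Z_c`:
`Z_c(p Q) = Z_c(p)`. [cite: KiKim2000, §2 eq. (2.1)] -/
theorem nonrealRootCount_mul_of_splits {p Q : ℝ[X]} (hp : p ≠ 0) (hQ : Q.Splits) (hQ0 : Q ≠ 0) :
    nonrealRootCount (p * Q) = nonrealRootCount p := by
  have hpq : p * Q ≠ 0 := mul_ne_zero hp hQ0
  have hQc : Q.roots.card = Q.natDegree := (splits_iff_card_roots.1 hQ)
  have h3 := card_roots' p
  unfold nonrealRootCount
  rw [natDegree_mul hp hQ0, roots_mul hpq, Multiset.card_add, hQc]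
  omega

/-! ## Orders of vanishing of polynomial functions -/

/-- Order of vanishing of a nonzero complex polynomial function `=` root multiplicity. [folklore] -/
private theorem analyticOrderNatAt_eval_eq_rootMultiplicity {D : ℂ[X]} (hD : D ≠ 0) (a : ℂ) :
    analyticOrderNatAt (fun z ↦ D.eval z) a = D.rootMultiplicity a := by
  set m := D.rootMultiplicity a with hm
  set r := D /ₘ (X - C a) ^ m with hr
  have hdec : (X - C a) ^ m * r = D := D.pow_mul_divByMonic_rootMultiplicity_eq a
  have hra : r.eval a ≠ 0 := eval_divByMonic_pow_rootMultiplicity_ne_zero a hD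
  have hfun : (fun z ↦ D.eval z) = ((· - a) ^ m) * fun z ↦ r.eval z := by
    funext z
    conv_lhs => rw [← hdec]
    simp [eval_pow]
  have h1 : AnalyticAt ℂ ((· - a) ^ m) a := by fun_prop
  have h2 : AnalyticAt ℂ (fun z ↦ r.eval z) a :=
    (AnalyticOnNhd.eval_polynomial r) a (Set.mem_univ _)
  rw [analyticOrderNatAt, hfun, analyticOrderAt_mul h1 h2, analyticOrderAt_centeredMonomial,
    h2.analyticOrderAt_eq_zero.mpr hra, add_zero, ENat.toNat_coe]

open Classical in
/-- The zeros of a nonzero polynomial function in a disc, counted with multiplicity, as a sum of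
root multiplicities over the roots in the disc. [folklore] -/
private theorem finsum_mem_ball_eval_eq {D : ℂ[X]} (hD : D ≠ 0) (c : ℂ) (r : ℝ) :
    ∑ᶠ z ∈ ball c r, analyticOrderNatAt (fun w ↦ D.eval w) z =
      ∑ z ∈ D.roots.toFinset.filter (fun z ↦ z ∈ ball c r), D.rootMultiplicity z := by
  classical
  rw [finsum_mem_eq_sum_of_inter_support_eq (fun z ↦ analyticOrderNatAt (fun w ↦ D.eval w) z)
    (t := D.roots.toFinset.filter (fun z ↦ z ∈ ball c r)) ?_]
  · exact Finset.sum_congr rfl fun z _ ↦ analyticOrderNatAt_eval_eq_rootMultiplicity hD z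
  · ext z
    simp only [mem_inter_iff, Function.mem_support, ne_eq, Finset.coe_filter, mem_setOf_eq,
      Multiset.mem_toFinset, mem_roots hD, IsRoot.def]
    constructor
    · rintro ⟨hz, hne⟩
      refine ⟨⟨?_, hz⟩, hne⟩
      rw [analyticOrderNatAt_eval_eq_rootMultiplicity hD] at hne
      by_contra h
      exact hne (rootMultiplicity_eq_zero h)
    · rintro ⟨⟨-, hz⟩, hne⟩
      exact ⟨hz, hne⟩

open Classical in
/-- `Z_c` of a nonzero real polynomial as the total multiplicity of its non-real complex roots.
[cite: CravenCsordas2006, p. 2 (Z_c)] -/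
private theorem sum_filter_rootMultiplicity_eq_nonrealRootCount {q : ℝ[X]} (hq : q ≠ 0) :
    ∑ z ∈ (q.map (algebraMap ℝ ℂ)).roots.toFinset.filter (fun z ↦ z.im ≠ 0),
      (q.map (algebraMap ℝ ℂ)).rootMultiplicity z = nonrealRootCount q := by
  classical
  set D := q.map (algebraMap ℝ ℂ) with hDdef
  have hD : D ≠ 0 := (Polynomial.map_ne_zero_iff (algebraMap ℝ ℂ).injective).2 hq
  rw [← nonrealZeroCount_eval q, nonrealZeroCount]
  have hsupp : (Function.support fun z : ℂ ↦
      if z.im = 0 then 0 else analyticOrderNatAt (fun w ↦ D.eval w) z) ⊆ (D.roots.toFinset : Set ℂ) := by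
    intro z hz
    rw [Function.mem_support] at hz
    rw [Finset.mem_coe, Multiset.mem_toFinset, mem_roots hD]
    by_contra hroot
    apply hz
    split_ifs
    · rfl
    · rw [analyticOrderNatAt_eval_eq_rootMultiplicity hD, rootMultiplicity_eq_zero hroot]
  rw [finsum_eq_sum_of_support_subset _ hsupp, Finset.sum_filter]
  refine Finset.sum_congr rfl fun z _ ↦ ?_
  by_cases hz : z.im = 0
  · simp [hz]
  · simp [hz, analyticOrderNatAt_eval_eq_rootMultiplicity hD z]

/-! ## Small devices -/

/-- If infinitely many approximants vanish identically, the limit is the zero function. [folklore] -/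
private theorem eq_zero_of_frequently_eq_zero' {P : ℕ → ℝ[X]}
    (hlim : TendstoLocallyUniformly (fun n z ↦ ((P n).map (algebraMap ℝ ℂ)).eval z) φ atTop)
    (h0 : ∃ᶠ n in atTop, P n = 0) : φ = 0 := by
  funext z
  have ht := (tendstoLocallyUniformlyOn_univ.2 hlim).tendsto_at (mem_univ z)
  have hfr : ∃ᶠ n in atTop, ((P n).map (algebraMap ℝ ℂ)).eval z ∈ ({0} : Set ℂ) :=
    h0.mono fun n hn ↦ by simp [hn]
  have hmem := mem_closure_of_frequently_of_tendsto hfr ht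
  rwa [closure_singleton, mem_singleton_iff] at hmem

/-- A zero `t` of `G ≢ 0` (entire) has positive finite order, and is isolated. [folklore] -/
private theorem order_pos_and_isolated {G : ℂ → ℂ} (hG : Differentiable ℂ G) (hne : ∃ w, G w ≠ 0)
    {t : ℂ} (ht : G t = 0) :
    0 < analyticOrderNatAt G t ∧ ∃ ε > 0, ∀ z, dist z t < ε → z ≠ t → G z ≠ 0 := by
  have han : AnalyticAt ℂ G t := hG.analyticAt t
  have hnot : ¬ (∀ᶠ z in 𝓝 t, G z = 0) := by
    intro hloc
    obtain ⟨w, hw⟩ := hne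
    exact hw ((hG.differentiableOn.analyticOnNhd isOpen_univ).eqOn_zero_of_preconnected_of_eventuallyEq_zero
      isPreconnected_univ (mem_univ t) hloc (mem_univ w))
  refine ⟨?_, ?_⟩
  · rw [analyticOrderNatAt]
    have hne_top : analyticOrderAt G t ≠ ⊤ := fun h ↦ hnot (analyticOrderAt_eq_top.1 h)
    have hne_zero : analyticOrderAt G t ≠ 0 := han.analyticOrderAt_ne_zero.2 ht
    cases h : analyticOrderAt G t with
    | top => exact absurd h hne_top
    | coe m =>
      rw [h] at hne_zero
      simp only [ENat.toNat_coe]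
      exact Nat.pos_of_ne_zero fun hm ↦ hne_zero (by simp [hm])
  · rcases han.eventually_eq_zero_or_eventually_ne_zero with h | h
    · exact absurd h hnot
    obtain ⟨ε, hε, hball⟩ := Metric.eventually_nhds_iff.1 (eventually_nhdsWithin_iff.1 h)
    exact ⟨ε, hε, fun z hz hzt ↦ hball hz hzt⟩

/-! ## The counting lemma -/

open Classical in
/-- **Key counting lemma (Rouché).** Let `F = p · φ` with `φ ∈ 𝓛𝓟`, `φ ≢ 0`, `p ≠ 0`, and
`F' ≢ 0`. For every finite set `T` of non-real zeros of `F'`: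
`∑_{t ∈ T} ord_t F' ≤ Z_c(p)`. [cite: KiKim2000, §2 p. 49] [cite: Conway1978, Ch. V Thm. 3.8] -/
private theorem sum_order_deriv_le (hφ : IsLaguerrePolya φ) (hφ0 : ∃ w, φ w ≠ 0) {p : ℝ[X]}
    (hp : p ≠ 0) (hF : ∀ z, F z = (p.map (algebraMap ℝ ℂ)).eval z * φ z)
    (hF' : ∃ w, deriv F w ≠ 0) (T : Finset ℂ)
    (hT : ∀ t ∈ T, deriv F t = 0 ∧ t.im ≠ 0) :
    ∑ t ∈ T, analyticOrderNatAt (deriv F) t ≤ nonrealRootCount p := by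
  classical
  obtain ⟨Q, hQ, hQlim⟩ := id hφ
  -- differentiability
  have hFfun : F = fun z ↦ (p.map (algebraMap ℝ ℂ)).eval z * φ z := funext hF
  have hFd : Differentiable ℂ F := by
    rw [hFfun]; exact (Polynomial.differentiable _).mul hφ.differentiable
  have hF'd : Differentiable ℂ (deriv F) := hFd.deriv
  -- the approximants `G_m = p Q_m` and their derivatives
  set G : ℕ → ℂ → ℂ := fun m z ↦ ((p * Q m).map (algebraMap ℝ ℂ)).eval z with hGdef
  have hGlim : TendstoLocallyUniformly G F atTop := by
    have hc : TendstoLocallyUniformly (fun _ : ℕ ↦ fun z ↦ (p.map (algebraMap ℝ ℂ)).eval z)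
        (fun z ↦ (p.map (algebraMap ℝ ℂ)).eval z) atTop :=
      (Metric.tendstoUniformly_iff.2 fun ε hε ↦ Eventually.of_forall fun n x ↦ by simpa using hε)
        |>.tendstoLocallyUniformly
    have h := hc.mul₀ hQlim (Polynomial.differentiable _).continuous hφ.continuous
    have hG' : G = ((fun _ : ℕ ↦ fun z ↦ (p.map (algebraMap ℝ ℂ)).eval z) *
        fun n z ↦ ((Q n).map (algebraMap ℝ ℂ)).eval z) := by
      funext m z
      simp [hGdef, Polynomial.map_mul]
    have hF2 : F = (fun z ↦ (p.map (algebraMap ℝ ℂ)).eval z) * φ := by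
      funext z
      simp [hF]
    rw [hG', hF2]
    exact h
  have hG'lim : TendstoLocallyUniformly
      (fun m z ↦ ((derivative (p * Q m)).map (algebraMap ℝ ℂ)).eval z) (deriv F) atTop := by
    have h1 := (tendstoLocallyUniformlyOn_univ.2 hGlim).deriv
      (Eventually.of_forall fun m ↦ (Polynomial.differentiable _).differentiableOn) isOpen_univ
    rw [tendstoLocallyUniformlyOn_univ] at h1
    convert h1 using 1
    funext m z
    simp only [Function.comp_apply, hGdef, Polynomial.deriv, Polynomial.derivative_map]
  -- radius: isolating, off the real axis, separating
  have hrad : ∀ t ∈ T, ∀ᶠ r in 𝓝[>] (0 : ℝ),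
      (∀ z, dist z t ≤ r → z ≠ t → deriv F z ≠ 0) ∧ r < |t.im| ∧
        ∀ t' ∈ T, t' ≠ t → 2 * r < dist t t' := by
    intro t ht
    obtain ⟨-, ε, hε, hiso⟩ := order_pos_and_isolated hF'd hF' (hT t ht).1
    have h1 : ∀ᶠ r in 𝓝[>] (0 : ℝ), r < ε :=
      eventually_nhdsWithin_of_eventually_nhds (eventually_lt_nhds hε)
    have h2 : ∀ᶠ r in 𝓝[>] (0 : ℝ), r < |t.im| :=
      eventually_nhdsWithin_of_eventually_nhds (eventually_lt_nhds (abs_pos.2 (hT t ht).2))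
    have h3 : ∀ᶠ r in 𝓝[>] (0 : ℝ), ∀ t' ∈ T, t' ≠ t → 2 * r < dist t t' := by
      refine (eventually_all_finset T).2 fun t' ht' ↦ ?_
      by_cases htt : t' = t
      · exact Eventually.of_forall fun r h ↦ absurd htt h
      · have hd : 0 < dist t t' / 2 := by
          have := dist_pos.2 (Ne.symm htt); linarith
        refine (eventually_nhdsWithin_of_eventually_nhds (eventually_lt_nhds hd)).mono
          fun r hr _ ↦ by linarith
    filter_upwards [h1, h2, h3] with r hr1 hr2 hr3
    exact ⟨fun z hz hzt ↦ hiso z (lt_of_le_of_lt hz hr1) hzt, hr2, hr3⟩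
  have hr0 : ∀ᶠ r in 𝓝[>] (0 : ℝ), 0 < r := eventually_mem_nhdsWithin
  obtain ⟨r, hrpos, hr⟩ := (hr0.and ((eventually_all_finset T).2 hrad)).exists
  -- on each circle `F'` is bounded below
  have hmin : ∀ t ∈ T, ∃ δ > 0, ∀ z ∈ sphere t r, δ ≤ ‖deriv F z‖ := by
    intro t ht
    have hne : (sphere t r).Nonempty := NormedSpace.sphere_nonempty.2 hrpos.le
    obtain ⟨z₀, hz₀, hminOn⟩ := (isCompact_sphere t r).exists_isMinOn hne hF'd.continuous.norm.continuousOn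
    refine ⟨‖deriv F z₀‖, norm_pos_iff.2 ?_, fun z hz ↦ hminOn hz⟩
    have hz₀' : dist z₀ t = r := mem_sphere.1 hz₀
    exact (hr t ht).1 z₀ hz₀'.le (fun h ↦ hrpos.ne' (by rw [← hz₀', h, dist_self]))
  -- for `m` large: the Rouché hypothesis on every circle, and `Q_m ≠ 0`
  have hev : ∀ᶠ m in atTop, (∀ t ∈ T, ∀ z ∈ sphere t r,
      ‖((derivative (p * Q m)).map (algebraMap ℝ ℂ)).eval z - deriv F z‖ < ‖deriv F z‖) ∧ Q m ≠ 0 := by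
    have hA : ∀ᶠ m in atTop, ∀ t ∈ T, ∀ z ∈ sphere t r,
        ‖((derivative (p * Q m)).map (algebraMap ℝ ℂ)).eval z - deriv F z‖ < ‖deriv F z‖ := by
      refine (eventually_all_finset T).2 fun t ht ↦ ?_
      obtain ⟨δ, hδ, hδle⟩ := hmin t ht
      have hunif := (tendstoLocallyUniformly_iff_forall_isCompact.1 hG'lim) _ (isCompact_sphere t r)
      refine ((Metric.tendstoUniformlyOn_iff.1 hunif) δ hδ).mono fun m hm z hz ↦ ?_
      have h := hm z hz
      rw [dist_eq_norm, ← norm_neg, neg_sub] at h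
      exact h.trans_le (hδle z hz)
    have hB : ∀ᶠ m in atTop, Q m ≠ 0 := by
      refine not_frequently.1 fun hfr ↦ ?_
      obtain ⟨w, hw⟩ := hφ0
      exact hw (by rw [eq_zero_of_frequently_eq_zero' hQlim hfr]; rfl)
    exact hA.and hB
  obtain ⟨m, hmA, hQm⟩ := hev.exists
  -- notation for the chosen approximant
  set D : ℂ[X] := (derivative (p * Q m)).map (algebraMap ℝ ℂ) with hDdef
  -- Rouché on each disc: `ord_t F' = ∑_{ball t r} ord (eval D)`
  have hcount : ∀ t ∈ T, analyticOrderNatAt (deriv F) t =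
      ∑ᶠ z ∈ ball t r, analyticOrderNatAt (fun w ↦ D.eval w) z := by
    intro t ht
    have hRouche := Rouche.finsum_analyticOrderNatAt_eq_of_norm_sub_lt (fun w ↦ D.eval w) (deriv F)
      t r hrpos ⟨univ, isOpen_univ, subset_univ _, (Polynomial.differentiable _).differentiableOn,
        hF'd.differentiableOn⟩ (fun z hz ↦ hmA t ht z hz)
    rw [hRouche]
    -- the only zero of `F'` in the ball is `t`
    have hsingle : ∑ᶠ z ∈ ball t r, analyticOrderNatAt (deriv F) z =
        ∑ᶠ z ∈ ({t} : Set ℂ), analyticOrderNatAt (deriv F) z := by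
      refine finsum_mem_inter_support_eq' _ _ _ fun z hz ↦ ?_
      rw [Function.mem_support] at hz
      constructor
      · intro hzball
        rw [mem_singleton_iff]
        by_contra hzt
        have hz0 : deriv F z = 0 := by
          by_contra hne
          exact hz (by
            rw [analyticOrderNatAt, ((hF'd.analyticAt z).analyticOrderAt_eq_zero).2 hne, ENat.toNat_zero])
        exact (hr t ht).1 z (le_of_lt (mem_ball.1 hzball)) hzt hz0
      · intro hzt
        rw [mem_singleton_iff] at hzt
        rw [hzt]
        exact mem_ball_self hrpos
    rw [hsingle, finsum_mem_singleton]
  -- the discs are off the real axis and pairwise disjoint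
  have hball_im : ∀ t ∈ T, ∀ z ∈ ball t r, z.im ≠ 0 := by
    intro t ht z hz him
    have h1 : |z.im - t.im| ≤ ‖z - t‖ := by
      simpa using Complex.abs_im_le_norm (z - t)
    have h2 : ‖z - t‖ < r := by rwa [← dist_eq_norm]
    have h3 := (hr t ht).2.1
    rw [him, zero_sub, abs_neg] at h1
    linarith
  have hdisj : ∀ t ∈ T, ∀ t' ∈ T, t ≠ t' → Disjoint (ball t r) (ball t' r) := by
    intro t ht t' ht' htt
    refine Set.disjoint_left.2 fun z hz hz' ↦ ?_
    have h := (hr t ht).2.2 t' ht' (Ne.symm htt)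
    have := dist_triangle_left t t' z
    rw [mem_ball] at hz hz'
    linarith
  -- sum over `T`, with the polynomial counts written as root multiplicities
  by_cases hD0 : D = 0
  · -- then every count vanishes, but orders at zeros of `F' ≢ 0` are positive: `T = ∅` in effect
    have : ∀ t ∈ T, analyticOrderNatAt (deriv F) t = 0 := by
      intro t ht
      rw [hcount t ht]
      have : (fun z : ℂ ↦ analyticOrderNatAt (fun w ↦ D.eval w) z) = fun _ ↦ 0 := by
        funext z
        rw [hD0]
        simp only [eval_zero]
        rw [analyticOrderNatAt, analyticOrderAt_eq_top.2 (Eventually.of_forall fun _ ↦ rfl),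
          ENat.toNat_top]
      rw [show (fun z : ℂ ↦ analyticOrderNatAt (fun w ↦ D.eval w) z) =
        (fun z ↦ analyticOrderNatAt (fun w ↦ D.eval w) z) from rfl] at this
      simp_rw [show ∀ z, analyticOrderNatAt (fun w ↦ D.eval w) z = 0 from fun z ↦ congrFun this z]
      simp
    rw [Finset.sum_eq_zero fun t ht ↦ this t ht]
    exact Nat.zero_le _
  have hcount' : ∀ t ∈ T, analyticOrderNatAt (deriv F) t =
      ∑ z ∈ D.roots.toFinset.filter (fun z ↦ z ∈ ball t r), D.rootMultiplicity z := by
    intro t ht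
    rw [hcount t ht, finsum_mem_ball_eval_eq hD0]
  rw [Finset.sum_congr rfl hcount']
  -- regroup as a sum over a subset of the non-real roots of `D`
  have hpd : (T : Set ℂ).PairwiseDisjoint
      (fun t ↦ D.roots.toFinset.filter (fun z ↦ z ∈ ball t r)) := by
    intro t ht t' ht' htt
    rw [Function.onFun, Finset.disjoint_left]
    intro z hz hz'
    rw [Finset.mem_filter] at hz hz'
    exact Set.disjoint_left.1 (hdisj t ht t' ht' htt) hz.2 hz'.2
  rw [← Finset.sum_biUnion hpd]
  have hsub : T.biUnion (fun t ↦ D.roots.toFinset.filter (fun z ↦ z ∈ ball t r))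
      ⊆ D.roots.toFinset.filter (fun z ↦ z.im ≠ 0) := by
    intro z hz
    rw [Finset.mem_biUnion] at hz
    obtain ⟨t, ht, hzt⟩ := hz
    rw [Finset.mem_filter] at hzt ⊢
    exact ⟨hzt.1, hball_im t ht z hzt.2⟩
  refine (Finset.sum_le_sum_of_subset hsub).trans ?_
  -- `Z_c(P_m') ≤ Z_c(P_m) = Z_c(p)`
  have hPQ : derivative (p * Q m) ≠ 0 := fun h ↦ hD0 (by rw [hDdef, h, Polynomial.map_zero])
  rw [hDdef, sum_filter_rootMultiplicity_eq_nonrealRootCount hPQ]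
  calc nonrealRootCount (derivative (p * Q m)) ≤ nonrealRootCount (p * Q m) :=
        nonrealRootCount_derivative_le _
    _ = nonrealRootCount p := nonrealRootCount_mul_of_splits hp (hQ m) hQm

/-! ## `Z_c(F') ≤ Z_c(F)` and finiteness -/

/-- **The non-real zeros of `F'` are finite in number**, for `F ∈ 𝓛𝓟*` with `F' ≢ 0`.
[cite: Kim1990, §1 p. 1045] [cite: KiKim2000, §2 p. 49] -/
theorem IsLaguerrePolyaStar.finite_nonreal_zeros_deriv (hF : IsLaguerrePolyaStar F)
    (hF' : ∃ w, deriv F w ≠ 0) : {z : ℂ | deriv F z = 0 ∧ z.im ≠ 0}.Finite := by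
  classical
  obtain ⟨p, φ, hφ, hFe⟩ := hF
  -- `F ≢ 0`, so `p ≠ 0` and `φ ≢ 0`
  have hF0 : ∃ w, F w ≠ 0 := by
    by_contra h
    push Not at h
    obtain ⟨w, hw⟩ := hF'
    exact hw (by rw [show F = fun _ ↦ (0 : ℂ) from funext h]; simp)
  obtain ⟨w₀, hw₀⟩ := hF0
  have hp : p ≠ 0 := by rintro rfl; exact hw₀ (by simp [hFe])
  have hφ0 : ∃ w, φ w ≠ 0 := ⟨w₀, fun h ↦ hw₀ (by simp [hFe, h])⟩
  by_contra hinf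
  obtain ⟨T, hTsub, hTcard⟩ := Set.Infinite.exists_subset_card_eq hinf (nonrealRootCount p + 1)
  have hT : ∀ t ∈ T, deriv F t = 0 ∧ t.im ≠ 0 := fun t ht ↦ hTsub (Finset.mem_coe.2 ht)
  have hle := sum_order_deriv_le hφ hφ0 hp hFe hF' T hT
  have hFd : Differentiable ℂ F := by
    rw [show F = fun z ↦ (p.map (algebraMap ℝ ℂ)).eval z * φ z from funext hFe]
    exact (Polynomial.differentiable _).mul hφ.differentiable
  have hpos : ∀ t ∈ T, 1 ≤ analyticOrderNatAt (deriv F) t := fun t ht ↦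
    (order_pos_and_isolated hFd.deriv hF' (hT t ht).1).1
  have : T.card ≤ ∑ t ∈ T, analyticOrderNatAt (deriv F) t := by
    rw [Finset.card_eq_sum_ones]
    exact Finset.sum_le_sum hpos
  omega

/-- **Differentiation does not increase the number of non-real zeros on `𝓛𝓟*`**:
`Z_c(F') ≤ Z_c(F)` (Pólya 1930; Kim 1990 §1; Ki–Kim 2000 §2). For `F` a polynomial or with
`F' ≡ 0` both sides are the honest counts or `0`.
[cite: Kim1990, §1 p. 1045] [cite: KiKim2000, §2 p. 49] -/
theorem IsLaguerrePolyaStar.nonrealZeroCount_deriv_le (hF : IsLaguerrePolyaStar F) :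
    nonrealZeroCount (deriv F) ≤ nonrealZeroCount F := by
  classical
  by_cases hF' : ∃ w, deriv F w ≠ 0
  swap
  · push Not at hF'
    rw [show deriv F = 0 from funext hF', nonrealZeroCount_zero]
    exact Nat.zero_le _
  obtain ⟨p, φ, hφ, hFe⟩ := id hF
  have hF0 : ∃ w, F w ≠ 0 := by
    by_contra h
    push Not at h
    obtain ⟨w, hw⟩ := hF'
    exact hw (by rw [show F = fun _ ↦ (0 : ℂ) from funext h]; simp)
  obtain ⟨w₀, hw₀⟩ := hF0
  have hp : p ≠ 0 := by rintro rfl; exact hw₀ (by simp [hFe])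
  have hφ0 : ∃ w, φ w ≠ 0 := ⟨w₀, fun h ↦ hw₀ (by simp [hFe, h])⟩
  -- `Z_c(F) = Z_c(p)`
  have hZF : nonrealZeroCount F = nonrealRootCount p := by
    rw [show F = fun z ↦ (p.map (algebraMap ℝ ℂ)).eval z * φ z from funext hFe]
    exact hφ.nonrealZeroCount_eval_mul hφ0 p
  rw [hZF]
  -- `Z_c(F')` is a finite sum over the non-real zeros of `F'`
  have hfin := hF.finite_nonreal_zeros_deriv hF'
  have hsupp : (Function.support fun z : ℂ ↦
      if z.im = 0 then 0 else analyticOrderNatAt (deriv F) z) ⊆ (hfin.toFinset : Set ℂ) := by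
    intro z hz
    rw [Function.mem_support] at hz
    rw [Finset.mem_coe, Set.Finite.mem_toFinset, mem_setOf_eq]
    by_cases hzi : z.im = 0
    · simp [hzi] at hz
    · refine ⟨?_, hzi⟩
      simp only [hzi, if_false] at hz
      by_contra hne
      have hFd : Differentiable ℂ (deriv F) := hF.differentiable.deriv
      exact hz (by rw [analyticOrderNatAt, ((hFd.analyticAt z).analyticOrderAt_eq_zero).2 hne,
        ENat.toNat_zero])
  unfold nonrealZeroCount
  rw [finsum_eq_sum_of_support_subset _ hsupp]
  have hT : ∀ t ∈ hfin.toFinset, deriv F t = 0 ∧ t.im ≠ 0 := fun t ht ↦ by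
    simpa using ht
  calc ∑ z ∈ hfin.toFinset, (if z.im = 0 then 0 else analyticOrderNatAt (deriv F) z)
      = ∑ z ∈ hfin.toFinset, analyticOrderNatAt (deriv F) z :=
        Finset.sum_congr rfl fun z hz ↦ by rw [if_neg (hT z hz).2]
    _ ≤ nonrealRootCount p := sum_order_deriv_le hφ hφ0 hp hFe hF' _ hT

/-! ## Closure of `𝓛𝓟* ∩ {order < 2}` under differentiation; the antitone sequence `Z_c(F^{(n)})` -/

/-- The derivative of a function of order `< 2` has order `< 2` (Cauchy's estimate;
`norm_deriv_le_of_growth`). [folklore] -/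
private theorem isEntireOfOrderLt_two_deriv (hF : IsEntireOfOrderLt 2 F) :
    IsEntireOfOrderLt 2 (deriv F) := by
  obtain ⟨hFd, ρ, C, hρ, hgr⟩ := hF
  obtain ⟨σ, C', hσ0, hσ, -, hgr'⟩ := DeBruijn1950.growth_normalise_two hFd hρ hgr
  obtain ⟨C'', h⟩ := norm_deriv_le_of_growth hFd hσ0 hσ hgr'
  exact ⟨hFd.deriv, (σ + 2) / 2, C'', by linarith, h⟩

/-- **`𝓛𝓟*` (order `< 2`) is closed under differentiation** (Kim 1990, §1): `F'` is real entire of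
order `< 2` with finitely many non-real zeros, hence in `𝓛𝓟*` by
`isLaguerrePolyaStar_of_isEntireOfOrderLt_two`. [cite: Kim1990, §1 p. 1045] [cite: KiKim2000, §2 p. 49] -/
theorem IsLaguerrePolyaStar.deriv (hF : IsLaguerrePolyaStar F) (hord : IsEntireOfOrderLt 2 F) :
    IsLaguerrePolyaStar (deriv F) := by
  by_cases hF' : ∃ w, _root_.deriv F w ≠ 0
  · have hreal : IsRealOnReal (_root_.deriv F) := fun x ↦
      im_deriv_ofReal hord.1 hF.isRealOnReal x
    exact isLaguerrePolyaStar_of_isEntireOfOrderLt_two (isEntireOfOrderLt_two_deriv hord) hreal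
      (hF.finite_nonreal_zeros_deriv hF')
  · push Not at hF'
    rw [show _root_.deriv F = 0 from funext hF']
    exact isLaguerrePolyaStar_zero

/-- … and under iterated differentiation. [cite: Kim1990, §1 p. 1045] -/
theorem IsLaguerrePolyaStar.iteratedDeriv' (hF : IsLaguerrePolyaStar F) (hord : IsEntireOfOrderLt 2 F)
    (n : ℕ) : IsLaguerrePolyaStar (iteratedDeriv n F) ∧ IsEntireOfOrderLt 2 (iteratedDeriv n F) := by
  induction n with
  | zero => simpa using ⟨hF, hord⟩
  | succ n ih =>
    rw [iteratedDeriv_succ]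
    exact ⟨ih.1.deriv ih.2, isEntireOfOrderLt_two_deriv ih.2⟩

/-- **`Z_c(F^{(n+1)}) ≤ Z_c(F^{(n)})`** for `F ∈ 𝓛𝓟*` of order `< 2` — statement (ii) of the
Jensen edge law (entire form). [cite: Kim1990, §1 p. 1045] [cite: KiKim2000, §2 p. 49] -/
theorem IsLaguerrePolyaStar.nonrealZeroCount_iteratedDeriv_succ_le (hF : IsLaguerrePolyaStar F)
    (hord : IsEntireOfOrderLt 2 F) (n : ℕ) :
    nonrealZeroCount (iteratedDeriv (n + 1) F) ≤ nonrealZeroCount (iteratedDeriv n F) := by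
  rw [iteratedDeriv_succ]
  exact (hF.iteratedDeriv' hord n).1.nonrealZeroCount_deriv_le

/-- The sequence `n ↦ Z_c(F^{(n)})` is non-increasing, for `F ∈ 𝓛𝓟*` of order `< 2`.
[cite: Kim1990, §1 p. 1045] [cite: KiKim2000, §2 p. 49] -/
theorem IsLaguerrePolyaStar.antitone_nonrealZeroCount_iteratedDeriv (hF : IsLaguerrePolyaStar F)
    (hord : IsEntireOfOrderLt 2 F) : Antitone fun n ↦ nonrealZeroCount (iteratedDeriv n F) :=
  antitone_nat_of_succ_le fun n ↦ hF.nonrealZeroCount_iteratedDeriv_succ_le hord n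

/-- In particular `Z_c(F^{(n)}) ≤ Z_c(F) = Z_c(p)` for all `n`. [cite: KiKim2000, §2 p. 49] -/
theorem IsLaguerrePolyaStar.nonrealZeroCount_iteratedDeriv_le (hF : IsLaguerrePolyaStar F)
    (hord : IsEntireOfOrderLt 2 F) (n : ℕ) :
    nonrealZeroCount (iteratedDeriv n F) ≤ nonrealZeroCount F := by
  have h := hF.antitone_nonrealZeroCount_iteratedDeriv hord (Nat.zero_le n)
  simpa using h

end Deriv

end Literature.Analysis.Complex

end
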